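import Summits.BirchSwinnertonDyer.Rank1Residual.X11b.KolyvaginTraceRelation
import Literature.NumberTheory.EllipticCurves.HeegnerPointsOfConductorPrimeLevelProofs
import Literature.NumberTheory.EllipticCurves.LFunctionPrimeCoeff
import Literature.NumberTheory.EllipticCurves.HeegnerHypothesisKroneckerProofs
import HarnessLib

/-!
# The X₀(N) Kolyvagin–Heegner FAMILY `y(m) = φ(x(m)) ∈ E(K[m])` at EVERY conductor, with Gross's norm relation (B4) in
# Kolyvagin's range-sum shape — the modular input of the «modular aux-norm» road
# Cell `bsd-stepL`, seat `bsd-line-er5-p1-w5` g0 (width seat on crux 19715 `EulerHalfNotRamNoInertSetAtFive`, line `birth`);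
# `--supports stmt-BirchSwinnertonDyer-19715 --as helper` (route-free)

WHY. The auxiliary-norm lever in its family-generic form (`ShimuraWalk.labelE0Prime_at_carrier_of_trace_of_galTrivial_of_kills_of_auxLevel`,
sibling file `ErratumRoadFiveEulerHalfAuxNormE0PrimeOfTrace`) consumes a family `ys : (m : ℕ) → E(K[m])` together with ONE label,
(B4) = Gross's norm relation at every square-free level on inert good primes, read as `∑_{i ≤ ℓ} σ^i ys(m) = a_ℓ • ys(m/ℓ)↑` in
`E(K[m])` for EVERY generator `σ` of `Gal(K[m]/K[m/ℓ])` (the fifth conjunct of `ShimuraWalk.LabelsAt`). For the modular curve `X₀(N)`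
everything needed is ALREADY a theorem of the tree: the complex CM points `y(m) = φ(x(m))` (`heegnerPointComplexOfConductor`) are
`K[m]`-rational at EVERY conductor `m ≠ 0` (`phi_heegnerPointOfConductor_mem_range_map_ringClassField_of_ne_zero`, Darmon Thm. 3.6 ∕
Gross §3), and Gross's Prop. 3.7 (1) holds for them at every inert good `ℓ ∤ m` with `(N, m) = 1`, `2 ≤ m ∨ d_K < −4` — NO Kolyvagin
condition on `ℓ`, NO hypothesis on the image of `ρ̄_{E,p}`, NO «no CM» (team x11b3's `sum_pointGalHom_eq_lFunction_smul_map` +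
`sum_range_pow_eq_sum_image`, `Rank1Residual/X11b/KolyvaginTraceRelation.lean`; `a_ℓ = W.LFunction ℓ = W.frobeniusTrace ℓ` at a good
prime, `LFunction_apply_prime_eq_frobeniusTrace`). This matters for the aux-norm road because the auxiliary level `ℓ₀ m` uses an inert
prime `ℓ₀` with `p ∤ a_{ℓ₀}` — NOT a Kolyvagin prime — where the named fact `GrossLMS1991.prop37_1_traceRelation` (Kolyvagin prime
factors only) would not apply.

WHAT. `exists_modularHeegnerFamily_trace`: for `W/ℚ` globally minimal elliptic, `N = N_E`, `K` imaginary quadratic with `d_K < −4`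
and `(N, d_K) = 1`, `ι : K → ℂ`, a parametrisation datum `Dt` at level `N` and an orientation `β` (`4N ∣ β² − d_K`): there is a family
`ys : (m : ℕ) → E(K[m])` with (i) `ys m ↦ φ(x(m))` for every `m ≠ 0` and (ii) (B4) VERBATIM in the shape of `ShimuraWalk.LabelsAt`'s
fifth conjunct at `N`. Corollaries: `modularHeegnerFamily_eq_y` (any Kolyvagin–Heegner datum `dm` of level `m ≠ 0` has `dm.y = ys m`
— `E(K[m]) → E(ℂ)` is injective), and the Heegner-hypothesis form `exists_modularHeegnerFamily_trace_of_satisfiesHeegnerHypothesis`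
(`(N, d_K) = 1` from the Heegner hypothesis).

HONEST FRAMING: THEOREMS ONLY (no definition — the family is an `∃`, no named fact, no instance, no `sorry`); classical CM theory
assembled from landed theorems; nothing about Selmer groups, `L`-values or BSD is asserted; no stub ∕ item closes; 19715 is not
closed by this; BSD is proved for no curve (T7); no summit statement is touched.
References (locators only): [cite: GrossLMS1991, §3 Prop. 3.7 (1) (p. 239–240), §3 (p. 238: `x_n` rational over `K_n`)]
[cite: Darmon2004, Thm. 3.6, Prop. 3.10] [cite: SilvermanAEC2009, §C.16 (a_p)].
presearch: «Heegner points ring class field trace relation every conductor» → tree theorems only (x11b3's `KolyvaginTraceRelation`,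
`HeegnerTraceRelationProofs.finsum_mem_ringClassGalOver_eq_frobeniusTrace_smul`, `HeegnerPointsOfConductorPrimeLevelProofs`);
[corpus:GrossLMS1991 p.239] Prop. 3.7 (1) is the printed statement; nothing new is claimed. Axioms: `propext`, `Classical.choice`, `Quot.sound`.
-/

set_option autoImplicit false
set_option linter.dupNamespace false

noncomputable section

open scoped Classical NumberField

namespace Summit.BirchSwinnertonDyer.BirchSwinnertonDyer.Theorems.ModularAuxNorm

open WeierstrassCurve NumberField Literature.NumberTheory.EllipticCurves
  Literature.NumberTheory.EllipticCurves.ModularForms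
  Summit.BirchSwinnertonDyer.Rank1Residual.X11b.RingClassTower

variable {K : Type} [Field K] [NumberField K]

/-- **Coprimality from a prime-factor guard**: if every prime factor of `m ≠ 0` fails to divide `N`, then `gcd(N, m) = 1`. [folklore] -/
theorem coprime_of_forall_primeFactors_not_dvd {N m : ℕ} (hm : m ≠ 0)
    (h : ∀ r ∈ m.primeFactors, ¬ r ∣ N) : Nat.Coprime N m := by
  rw [Nat.coprime_comm, Nat.coprime_iff_gcd_eq_one]
  by_contra hne
  obtain ⟨r, hr, hrdvd⟩ := Nat.exists_prime_and_dvd hne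
  have hrm : r ∣ m := hrdvd.trans (Nat.gcd_dvd_left m N)
  have hrN : r ∣ N := hrdvd.trans (Nat.gcd_dvd_right m N)
  exact h r (Nat.mem_primeFactors.mpr ⟨hr, hrm, hm⟩) hrN

/-- **The X₀(N) Kolyvagin–Heegner family with Gross's norm relation (B4) at EVERY square-free level on inert good primes.**
For `W/ℚ` a globally minimal elliptic curve of conductor `N = N_E`, `K` imaginary quadratic with `d_K < −4` and `gcd(N, d_K) = 1`,
`ι : K → ℂ`, a modular parametrisation datum `Dt` at level `N` and an orientation `β` with `4N ∣ β² − d_K`, there is a family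
`ys : (m : ℕ) → E(K[m])` such that
(i) for every `m ≠ 0`, `ys m ↦ y(m) = φ(x(m))` under `E(K[m]) ⊆ E(ℂ)` (Darmon Thm. 3.6: `φ(x(m))` is `K[m]`-rational), and
(ii) (B4): for every square-free `m` all of whose prime factors are inert in `K` and prime to `N`, every prime `ℓ ∣ m`, every
generator `σ` of `G_ℓ = Gal(K[m]/K[m/ℓ])`: `∑_{i=0}^{ℓ} σ^i • ys m = a_ℓ • (ys (m/ℓ))↑` in `E(K[m])` (Gross Prop. 3.7 (1):
`Tr_ℓ y_m = a_ℓ y_{m/ℓ}`; `#G_ℓ = ℓ + 1`, `a_ℓ = W.frobeniusTrace ℓ` at the good prime `ℓ ∤ N`) — VERBATIM the fifth conjunct of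
`ShimuraWalk.LabelsAt W N K ι y ys ε`. [cite: GrossLMS1991, §3 Prop. 3.7 (1) (p. 239–240), §3 p. 238] [cite: Darmon2004, Thm. 3.6, Prop. 3.10] -/
theorem exists_modularHeegnerFamily_trace (W : WeierstrassCurve ℚ) [W.IsElliptic] [W.IsGloballyMinimal]
    [NeZero (W.conductorNorm ℤ)] (hK : IsImaginaryQuadratic K) (hD : NumberField.discr K < -4)
    (hND : IsCoprime (W.conductorNorm ℤ : ℤ) (NumberField.discr K)) (ι : K →+* ℂ)
    (Dt : ModularParametrizationData W (W.conductorNorm ℤ)) (β : ℤ)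
    (hβ : (4 * (W.conductorNorm ℤ : ℕ) : ℤ) ∣ β ^ 2 - NumberField.discr K) :
    ∃ ys : (m : ℕ) → (W.baseChange (ringClassField K ι m)).toAffine.Point,
      (∀ m : ℕ, m ≠ 0 →
        WeierstrassCurve.Affine.Point.map (W' := W) (ringClassField K ι m).subtype.toRatAlgHom (ys m) =
          heegnerPointComplexOfConductor Dt (NumberField.discr K) β m) ∧
      (∀ m : ℕ, Squarefree m →
        (∀ r ∈ m.primeFactors, ¬ r ∣ W.conductorNorm ℤ ∧ (Ideal.span {(r : 𝓞 K)}).IsPrime) →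
        ∀ (ℓ : ℕ) (_ : ℓ ∈ m.primeFactors) (hle : ringClassField K ι (m / ℓ) ≤ ringClassField K ι m)
          (σ : ringClassField K ι m ≃ₐ[ℚ] ringClassField K ι m),
          Subgroup.zpowers σ = ringClassGalOver ι m (m / ℓ) →
          letI : Algebra K ℂ := ι.toAlgebra
          ∑ i ∈ Finset.range (ℓ + 1), pointGalHom W (ringClassField K ι m) (σ ^ i) (ys m) =
            W.frobeniusTrace ℓ • WeierstrassCurve.Affine.Point.map (W' := W)
              ((RingClassField.inclusion ι hle).restrictScalars ℚ) (ys (m / ℓ))) := by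
  -- (i) the family: a `K[m]`-rational point over `φ(x(m))` at every `m ≠ 0` (Darmon Thm. 3.6), anything at `m = 0`
  have hrat : ∀ m : ℕ, ∃ P : (W.baseChange (ringClassField K ι m)).toAffine.Point, m ≠ 0 →
      WeierstrassCurve.Affine.Point.map (W' := W) (ringClassField K ι m).subtype.toRatAlgHom P =
        heegnerPointComplexOfConductor Dt (NumberField.discr K) β m := by
    intro m
    by_cases hm : m = 0
    · exact ⟨0, fun h ↦ (h hm).elim⟩
    · obtain ⟨P, hP⟩ :=
        phi_heegnerPointOfConductor_mem_range_map_ringClassField_of_ne_zero (W.conductorNorm ℤ) W K hK Dt β ι m hβ hm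
      exact ⟨P, fun _ ↦ hP⟩
  choose ys hys using hrat
  refine ⟨ys, hys, ?_⟩
  -- (ii) (B4) at a square-free level `m` with inert good prime factors, `ℓ ∣ m`, `σ` a generator of `G_ℓ`
  intro m hm hg ℓ hℓm hle σ hσ
  have hℓ : ℓ.Prime := Nat.prime_of_mem_primeFactors hℓm
  haveI : Fact ℓ.Prime := ⟨hℓ⟩
  have hm0 : m ≠ 0 := hm.ne_zero
  have hℓdvd : ℓ ∣ m := Nat.dvd_of_mem_primeFactors hℓm
  have hn : ℓ * (m / ℓ) = m := Nat.mul_div_cancel' hℓdvd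
  have hm'0 : m / ℓ ≠ 0 := fun h ↦ hm0 (by rw [← hn, h, mul_zero])
  have hℓm' : ¬ ℓ ∣ m / ℓ := by
    intro h
    have hsq : ℓ * ℓ ∣ m := hn ▸ mul_dvd_mul_left ℓ h
    exact hℓ.one_lt.ne' (Nat.isUnit_iff.mp (hm ℓ hsq))
  have hℓN : ¬ ℓ ∣ W.conductorNorm ℤ := (hg ℓ hℓm).1
  have hinert : (Ideal.span {(ℓ : 𝓞 K)}).IsPrime := (hg ℓ hℓm).2
  have hm'dvd : m / ℓ ∣ m := Nat.div_dvd_of_dvd hℓdvd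
  have hNm' : Nat.Coprime (W.conductorNorm ℤ) (m / ℓ) :=
    coprime_of_forall_primeFactors_not_dvd hm'0 fun r hr ↦ (hg r (Nat.primeFactors_mono hm'dvd hm0 hr)).1
  have hunits : 2 ≤ m / ℓ ∨ NumberField.discr K < -4 := Or.inr hD
  -- `a_ℓ = W.LFunction ℓ = W.frobeniusTrace ℓ` at the good prime `ℓ ∤ N_E`
  have hgood : W.HasGoodReductionAtPrime ℓ :=
    not_not.mp (mt (W.dvd_conductorNorm_iff_not_hasGoodReductionAtPrime ℓ).mpr hℓN)
  have ha : W.LFunction ℓ = W.frobeniusTrace ℓ := WeierstrassCurve.LFunction_apply_prime_eq_frobeniusTrace W ℓ hgood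
  -- enumerate `G_ℓ` by the powers of `σ` and apply Prop. 3.7 (1) for the concrete points
  have h1 := sum_range_pow_eq_sum_image hK ι hn hℓ hinert hℓm' hm'0 hunits hσ
    (fun g => pointGalHom W (ringClassField K ι m) g (ys m))
  have h2 := sum_pointGalHom_eq_lFunction_smul_map hK ι Dt hND hβ hn hℓ hinert hℓN hℓm' hm'0 hNm' hunits hle
    (fun g => mem_image_pow_iff_mem_ringClassGalOver hK ι hn hℓ hinert hℓm' hm'0 hunits hσ g)
    (hys m hm0) (hys (m / ℓ) hm'0)
  rw [ha] at h2
  exact h1.trans h2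

/-- **Any Kolyvagin–Heegner datum's point IS the family's point**: `E(K[m]) → E(ℂ)` is injective and both map to `φ(x(m))`.
[cite: GrossLMS1991, §3 (p. 238)] -/
theorem eq_of_map_eq_heegnerPointComplexOfConductor (W : WeierstrassCurve ℚ) {N : ℕ} [NeZero N]
    (ι : K →+* ℂ) (Dt : ModularParametrizationData W N) (β : ℤ) {m : ℕ}
    {P Q : (W.baseChange (ringClassField K ι m)).toAffine.Point}
    (hP : WeierstrassCurve.Affine.Point.map (W' := W) (ringClassField K ι m).subtype.toRatAlgHom P =
      heegnerPointComplexOfConductor Dt (NumberField.discr K) β m)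
    (hQ : WeierstrassCurve.Affine.Point.map (W' := W) (ringClassField K ι m).subtype.toRatAlgHom Q =
      heegnerPointComplexOfConductor Dt (NumberField.discr K) β m) : P = Q :=
  WeierstrassCurve.Affine.Point.map_injective (f := (ringClassField K ι m).subtype.toRatAlgHom) (hP.trans hQ.symm)

/-- **The family under the Heegner hypothesis.** Same as `exists_modularHeegnerFamily_trace` with `gcd(N, d_K) = 1` supplied by the
Heegner hypothesis (every prime of `N` splits in `K`, so none ramifies). [cite: GrossLMS1991, §1 (p. 235), §3 Prop. 3.7 (1)] -/
theorem exists_modularHeegnerFamily_trace_of_satisfiesHeegnerHypothesis (W : WeierstrassCurve ℚ) [W.IsElliptic]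
    [W.IsGloballyMinimal] [NeZero (W.conductorNorm ℤ)] (hK : IsImaginaryQuadratic K) (hD : NumberField.discr K < -4)
    (hH : SatisfiesHeegnerHypothesis (W.conductorNorm ℤ) K) (ι : K →+* ℂ)
    (Dt : ModularParametrizationData W (W.conductorNorm ℤ)) (β : ℤ)
    (hβ : (4 * (W.conductorNorm ℤ : ℕ) : ℤ) ∣ β ^ 2 - NumberField.discr K) :
    ∃ ys : (m : ℕ) → (W.baseChange (ringClassField K ι m)).toAffine.Point,
      (∀ m : ℕ, m ≠ 0 →
        WeierstrassCurve.Affine.Point.map (W' := W) (ringClassField K ι m).subtype.toRatAlgHom (ys m) =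
          heegnerPointComplexOfConductor Dt (NumberField.discr K) β m) ∧
      (∀ m : ℕ, Squarefree m →
        (∀ r ∈ m.primeFactors, ¬ r ∣ W.conductorNorm ℤ ∧ (Ideal.span {(r : 𝓞 K)}).IsPrime) →
        ∀ (ℓ : ℕ) (_ : ℓ ∈ m.primeFactors) (hle : ringClassField K ι (m / ℓ) ≤ ringClassField K ι m)
          (σ : ringClassField K ι m ≃ₐ[ℚ] ringClassField K ι m),
          Subgroup.zpowers σ = ringClassGalOver ι m (m / ℓ) →
          letI : Algebra K ℂ := ι.toAlgebra
          ∑ i ∈ Finset.range (ℓ + 1), pointGalHom W (ringClassField K ι m) (σ ^ i) (ys m) =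
            W.frobeniusTrace ℓ • WeierstrassCurve.Affine.Point.map (W' := W)
              ((RingClassField.inclusion ι hle).restrictScalars ℚ) (ys (m / ℓ))) := by
  have hND : IsCoprime (W.conductorNorm ℤ : ℤ) (NumberField.discr K) := by
    refine Int.isCoprime_iff_gcd_eq_one.mpr ?_
    rw [Int.gcd_eq_natAbs, Int.natAbs_natCast]
    exact Literature.SatisfiesHeegnerHypothesis.coprime_discr hK.1 hH
  exact exists_modularHeegnerFamily_trace W hK hD hND ι Dt β hβ

end Summit.BirchSwinnertonDyer.BirchSwinnertonDyer.Theorems.ModularAuxNorm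

end
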